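import Summits.QuantumFields.BalabanUV.Beta.GAN24.SlotDefectWindowShapes

/-!
# `BalabanUV.Beta.GAN24.SlotDivergenceLetters` — binder row G-an2-4 ∕ (CONV-C), CT-W, route of record «WC-TL» (RULING R-gan24p1-g24-1 ∕ -2; the row owner's
# `gen25/QR-DESIGN-v0.md` §0 ∕ §5 Q4 «`Δ_S b̃_j` (source divergences) are bounded images (`‖div‖ ≤ 2(d+1)`) of p2's F4 rows»), PART 3 of the journal INTENT
# [LEAF02-G53-ONLINE] «ι-WIN»: **THE SLOT DIVERGENCES OF A `LocStencil₂` TABLE CARRY THE ι-WIN LETTERS — `(d+1)(e^{3δ}+1)·C` (first slot), `(d+1)(e^{δ}+1)·C` (second slot),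
# `(d+1)²(e^{3δ}+1)(e^{δ}+1)·C` (double), same rate — AND THE LETTERS ADD**

NOT IN PRINT; OUR BOOKKEEPING (G-an2-4 crux team (2), leaf prover `b2b-balaban-gan24-formalise-leaf-02`, gen 53).  [folklore] one-step exponential bookkeeping
(`ExpKernelCalculus.l1_sub_triangle ∕ l1_sub_symm`, `StepJetData.l1_unitVec`) over D1's `KernelWard.divV`; generic `d + 1`; 0 `def`, 0 cited facts, 0 `def … : Prop`, 0 sorry.
WHY: the slaved first-slot divergence of the comb member one level up is `divW (b♮̃_j) + (S-step terms)` (leaf-06 `T2SlavedDivergence.divW_member_succ_eq_slaved` ✓ p316380);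
the SOURCE summand's letter is THIS file applied to p2's F4 `LocStencil₂ (b♮̃_j)` rows (uniform in `j` ✓), the S-step summand's letter is (Q-R) ∘ (LAY) ∘ (LT) (QR-DESIGN §3,
not here); letters add (§3); PART 2 `SlotDefectWindowShapes` turns the sum into `LocStencil₂` of the defects `D_{2}`, `D_{1}`, `D_{2,1}` of T-DL.
HONEST FRAMING (cell contract, verbatim): «discharging `BetaPertH` makes Bałaban's UV stability UNCONDITIONAL — a real constructive-QFT result; it is NOT the
continuum limit and NOT the Clay problem.»  HONEST DEPENDENCY (verbatim): «continuum YM on T⁴ ⇐ BetaPertH ∧ nine spine estimates (0/9 proved); BetaPertH ⇐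
(D1) ∧ (D4) ∧ CAP+tail; G-an2-4 gates asym, D1 and NE2/3/4.»

## What (`0 ≤ δ`; `divV V y = Σ_μ (V μ (y − e_μ) − V μ y)`)
* §1 `exp_shift_unit_le` — `e^{−δ|w − (p − e_μ)|₁} ≤ e^{δ} · e^{−δ|w − p|₁}`; `exp_shift_unit_le'` — `e^{−δ|(p − e_μ) − u|₁} ≤ e^{δ} · e^{−δ|p − u|₁}` (`|e_μ|₁ = 1`:
  `StepJetData.l1_unitVec` ∕ `StaircaseFaces.l1_unitVec_eq_one`, bridged inline — not restated).
* §2 **`letter_fst_of_locStencil₂`** — `LocStencil₂ T C δ ⟹ |(divV (κ₁ u₁ ↦ T κ₁ u₁ κ′ u′) p) x z a b| ≤ (d+1)(e^{3δ}+1)·C · e^{−δ|u′ − p|₁} · e^{−δ(|x − p|₁ + |z − p|₁)}`;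
  **`letter_snd_of_locStencil₂`** — `… |(divV (κ₁ u₁ ↦ T κ u κ₁ u₁) p) x z a b| ≤ (d+1)(e^{δ}+1)·C · e^{−δ|p − u|₁} · e^{−δ(|x − u|₁ + |z − u|₁)}`;
  **`letter_fst_snd_of_locStencil₂`** — `… |(divV (κ₂ u₂ ↦ divV (κ₁ u₁ ↦ T κ₁ u₁ κ₂ u₂) p) p′) x z a b| ≤ (d+1)²(e^{3δ}+1)(e^{δ}+1)·C · e^{−δ|p′ − p|₁} · e^{−δ(|x − p|₁ + |z − p|₁)}`
  — the three letters of PART 2 §3 ∕ §2 ∕ §4 for ANY `LocStencil₂` table (so for the dressed sources `b♮̃_j` by p2's F4 rows, uniformly in `j`).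
* §3 `divV_add_apply`, `divV_fst_add`, `divV_snd_add`, `divV_fst_snd_add` — the slot divergences are additive in the table (entrywise), so letters of summands add.
* §4 DOCKING CHECK (corollaries, PART 2 ∘ §2): for a plain `LocStencil₂ T C δ` table the window route returns `LocStencil₂` bounds of the three pure-source defects
  `P₂ T − T`, `P₁ T − T`, `P₁ (P₂ T − T) − (P₂ T − T)` by `T`'s own constant (`locStencil₂_coProj_snd ∕ fst_sub_self_of_locStencil₂`, `locStencil₂_defect_fst_snd_of_locStencil₂`)
  — the consistency twin of leaf-06's `TableDressingDefect.locStencil₂_tableDress_sub_self` (whole `𝔇 − 1`, by `X`); under «WC-TL» the letters come from the SLAVED data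
  instead, through the same two terms.
Asserts NO value of any divergence of Bałaban's tables; discharges NOTHING of (Q-D) ∕ (H) ∕ (Q-R) ∕ (Q-L) ∕ «T2Shape» ∕ «T2Drift» ∕ (hW, hWall); 0 wall binders; NEVER «G-an2-4 closed»
as (CONV-C); NOT D1, NOT `BetaPertH`, NOT continuum, NOT Clay; not in print — our bookkeeping.  Unit `b2b-balaban-gan24-formalise-leaf-02` (gen 53), 2026-08-22.
-/

noncomputable section

open Finset
open scoped BigOperators
open Literature.MathematicalPhysics.QuantumFieldTheory
open Literature.MathematicalPhysics.QuantumFieldTheory.Balaban1983to89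
open Literature.MathematicalPhysics.QuantumFieldTheory.Balaban1983to89.Beta
open B12Sec2to5 (l1 l1_nonneg)
open ExpKernelCalculus (MKer Site l1_sub_triangle l1_sub_symm)
open AffineAveraging (Form0 Form1 box toSite unitVec)
open OneStepResolventKernel (Fib)
open KernelWard (divV)
open BalabanCompositeJets (LocStencil₂)
open StepJetData (l1_unitVec)
open Summit.QuantumFields.BalabanUV.Beta.GAN24.BiStencilZeroMode (Tab)
open Summit.QuantumFields.BalabanUV.Beta.AxialDressingRooted (coProjBmAtK)
open Summit.QuantumFields.BalabanUV.Beta.GAN24.SlotDefectWindowBound (divV_apply)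
open Summit.QuantumFields.BalabanUV.Beta.GAN24.SlotDefectWindowShapes (locStencil₂_coProj_fst_sub_self_of_div locStencil₂_coProj_snd_sub_self_of_div
  locStencil₂_defect_fst_snd_of_div₂)

namespace Summit.QuantumFields.BalabanUV.Beta.GAN24.SlotDivergenceLetters

variable {d : ℕ}

/-! ## §1 One unit step costs `e^{δ}` -/

/-- [folklore] Moving the centre by one unit vector: `e^{−δ|w − (p − e_μ)|₁} ≤ e^{δ} · e^{−δ|w − p|₁}` (`δ ≥ 0`). -/
theorem exp_shift_unit_le {δ : ℝ} (hδ : 0 ≤ δ) (w p : Fin (d + 1) → ℤ) (μ : Fin (d + 1)) :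
    Real.exp (-δ * l1 (w - (p - unitVec μ))) ≤ Real.exp δ * Real.exp (-δ * l1 (w - p)) := by
  have h1 : l1 (w - p) ≤ l1 (w - (p - unitVec μ)) + l1 ((p - unitVec μ) - p) := l1_sub_triangle w (p - unitVec μ) p
  have h2 : l1 ((p - unitVec μ) - p) = 1 := by
    rw [l1_sub_symm, show p - (p - unitVec μ) = unitVec μ by abel,
      show (unitVec μ : Fin (d + 1) → ℤ) = B6BondElimination.unitVec μ by
        funext i; simp only [B6BondElimination.unitVec, AffineAveraging.unitVec, Pi.single_apply]]
    exact l1_unitVec μ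
  rw [← Real.exp_add]
  exact Real.exp_le_exp.2 (by nlinarith)

/-- [folklore] Moving the point by one unit vector: `e^{−δ|(p − e_μ) − u|₁} ≤ e^{δ} · e^{−δ|p − u|₁}` (`δ ≥ 0`). -/
theorem exp_shift_unit_le' {δ : ℝ} (hδ : 0 ≤ δ) (p u : Fin (d + 1) → ℤ) (μ : Fin (d + 1)) :
    Real.exp (-δ * l1 ((p - unitVec μ) - u)) ≤ Real.exp δ * Real.exp (-δ * l1 (p - u)) := by
  have h1 : l1 (p - u) ≤ l1 (p - (p - unitVec μ)) + l1 ((p - unitVec μ) - u) := l1_sub_triangle p (p - unitVec μ) u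
  have h2 : l1 (p - (p - unitVec μ)) = 1 := by
    rw [show p - (p - unitVec μ) = unitVec μ by abel,
      show (unitVec μ : Fin (d + 1) → ℤ) = B6BondElimination.unitVec μ by
        funext i; simp only [B6BondElimination.unitVec, AffineAveraging.unitVec, Pi.single_apply]]
    exact l1_unitVec μ
  rw [← Real.exp_add]
  exact Real.exp_le_exp.2 (by nlinarith)

/-! ## §2 The letters of a `LocStencil₂` table -/

section Letters

variable {T : Tab d} {C δ : ℝ}

/-- NOT IN PRINT; OUR BOOKKEEPING.  **THE FIRST-SLOT DIVERGENCE OF A `LocStencil₂` TABLE CARRIES THE SITE-CENTRED LETTER** (PART 2 §2's hypothesis; `δ ≥ 0`):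
`|(divV (κ₁ u₁ ↦ T κ₁ u₁ κ′ u′) p) x z a b| ≤ (d+1)(e^{3δ}+1)·C · e^{−δ|u′ − p|₁} · e^{−δ(|x − p|₁ + |z − p|₁)}`. -/
theorem letter_fst_of_locStencil₂ (hT : LocStencil₂ T C δ) (hδ : 0 ≤ δ) (p : Fin (d + 1) → ℤ) (κ' : Fin (d + 1)) (u' x z : Fin (d + 1) → ℤ) (a b : Fib d) :
    |divV (fun κ₁ u₁ => T κ₁ u₁ κ' u') p x z a b|
      ≤ ((d : ℝ) + 1) * (Real.exp (3 * δ) + 1) * C * Real.exp (-δ * l1 (u' - p)) * Real.exp (-δ * (l1 (x - p) + l1 (z - p))) := by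
  have hC : 0 ≤ C := hT.nonneg
  set E := Real.exp (-δ * l1 (u' - p)) * Real.exp (-δ * (l1 (x - p) + l1 (z - p))) with hE
  have hE0 : 0 ≤ E := mul_nonneg (Real.exp_pos _).le (Real.exp_pos _).le
  have h3 : Real.exp (3 * δ) = Real.exp δ * Real.exp δ * Real.exp δ := by rw [← Real.exp_add, ← Real.exp_add]; congr 1; ring
  -- the shifted term
  have hshift : ∀ μ : Fin (d + 1), |T μ (p - unitVec μ) κ' u' x z a b| ≤ Real.exp (3 * δ) * C * E := by
    intro μ
    have h := hT μ (p - unitVec μ) κ' u' x z a b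
    have r1 := exp_shift_unit_le hδ u' p μ
    have r2 := exp_shift_unit_le hδ x p μ
    have r3 := exp_shift_unit_le hδ z p μ
    have split : Real.exp (-δ * (l1 (x - (p - unitVec μ)) + l1 (z - (p - unitVec μ))))
        = Real.exp (-δ * l1 (x - (p - unitVec μ))) * Real.exp (-δ * l1 (z - (p - unitVec μ))) := by rw [← Real.exp_add]; congr 1; ring
    have split' : Real.exp (-δ * (l1 (x - p) + l1 (z - p))) = Real.exp (-δ * l1 (x - p)) * Real.exp (-δ * l1 (z - p)) := by
      rw [← Real.exp_add]; congr 1; ring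
    rw [hE, split', h3]
    rw [split] at h
    calc |T μ (p - unitVec μ) κ' u' x z a b|
        ≤ C * Real.exp (-δ * l1 (u' - (p - unitVec μ))) * (Real.exp (-δ * l1 (x - (p - unitVec μ))) * Real.exp (-δ * l1 (z - (p - unitVec μ)))) := h
      _ ≤ C * (Real.exp δ * Real.exp (-δ * l1 (u' - p))) * ((Real.exp δ * Real.exp (-δ * l1 (x - p))) * (Real.exp δ * Real.exp (-δ * l1 (z - p)))) := by
          refine mul_le_mul (mul_le_mul_of_nonneg_left r1 hC) (mul_le_mul r2 r3 (Real.exp_pos _).le (mul_nonneg (Real.exp_pos _).le (Real.exp_pos _).le))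
            (mul_nonneg (Real.exp_pos _).le (Real.exp_pos _).le) (mul_nonneg hC (mul_nonneg (Real.exp_pos _).le (Real.exp_pos _).le))
      _ = Real.exp δ * Real.exp δ * Real.exp δ * C * (Real.exp (-δ * l1 (u' - p)) * (Real.exp (-δ * l1 (x - p)) * Real.exp (-δ * l1 (z - p)))) := by ring
  -- the unshifted term
  have hplain : ∀ μ : Fin (d + 1), |T μ p κ' u' x z a b| ≤ C * E := by
    intro μ
    rw [hE, ← mul_assoc]
    exact hT μ p κ' u' x z a b
  rw [divV_apply]
  calc |∑ μ : Fin (d + 1), (T μ (p - unitVec μ) κ' u' x z a b - T μ p κ' u' x z a b)|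
      ≤ ∑ μ : Fin (d + 1), |T μ (p - unitVec μ) κ' u' x z a b - T μ p κ' u' x z a b| := Finset.abs_sum_le_sum_abs _ _
    _ ≤ ∑ _μ : Fin (d + 1), (Real.exp (3 * δ) * C * E + C * E) := Finset.sum_le_sum fun μ _ =>
        (abs_sub _ _).trans (add_le_add (hshift μ) (hplain μ))
    _ = ((d : ℝ) + 1) * (Real.exp (3 * δ) + 1) * C * Real.exp (-δ * l1 (u' - p)) * Real.exp (-δ * (l1 (x - p) + l1 (z - p))) := by
        rw [Finset.sum_const, Finset.card_univ, Fintype.card_fin, nsmul_eq_mul, hE]; push_cast; ring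

/-- NOT IN PRINT; OUR BOOKKEEPING.  **THE SECOND-SLOT DIVERGENCE OF A `LocStencil₂` TABLE CARRIES THE FIRST-SLOT-CENTRED LETTER** (PART 2 §3's hypothesis; `δ ≥ 0`):
`|(divV (κ₁ u₁ ↦ T κ u κ₁ u₁) p) x z a b| ≤ (d+1)(e^{δ}+1)·C · e^{−δ|p − u|₁} · e^{−δ(|x − u|₁ + |z − u|₁)}`. -/
theorem letter_snd_of_locStencil₂ (hT : LocStencil₂ T C δ) (hδ : 0 ≤ δ) (κ : Fin (d + 1)) (u p x z : Fin (d + 1) → ℤ) (a b : Fib d) :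
    |divV (fun κ₁ u₁ => T κ u κ₁ u₁) p x z a b|
      ≤ ((d : ℝ) + 1) * (Real.exp δ + 1) * C * Real.exp (-δ * l1 (p - u)) * Real.exp (-δ * (l1 (x - u) + l1 (z - u))) := by
  have hC : 0 ≤ C := hT.nonneg
  set E := Real.exp (-δ * l1 (p - u)) * Real.exp (-δ * (l1 (x - u) + l1 (z - u))) with hE
  have hshift : ∀ μ : Fin (d + 1), |T κ u μ (p - unitVec μ) x z a b| ≤ Real.exp δ * C * E := by
    intro μ
    have h := hT κ u μ (p - unitVec μ) x z a b
    have r1 := exp_shift_unit_le' hδ p u μ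
    rw [hE]
    calc |T κ u μ (p - unitVec μ) x z a b|
        ≤ C * Real.exp (-δ * l1 ((p - unitVec μ) - u)) * Real.exp (-δ * (l1 (x - u) + l1 (z - u))) := h
      _ ≤ C * (Real.exp δ * Real.exp (-δ * l1 (p - u))) * Real.exp (-δ * (l1 (x - u) + l1 (z - u))) :=
          mul_le_mul_of_nonneg_right (mul_le_mul_of_nonneg_left r1 hC) (Real.exp_pos _).le
      _ = Real.exp δ * C * (Real.exp (-δ * l1 (p - u)) * Real.exp (-δ * (l1 (x - u) + l1 (z - u)))) := by ring
  have hplain : ∀ μ : Fin (d + 1), |T κ u μ p x z a b| ≤ C * E := by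
    intro μ
    rw [hE, ← mul_assoc]
    exact hT κ u μ p x z a b
  rw [divV_apply]
  calc |∑ μ : Fin (d + 1), (T κ u μ (p - unitVec μ) x z a b - T κ u μ p x z a b)|
      ≤ ∑ μ : Fin (d + 1), |T κ u μ (p - unitVec μ) x z a b - T κ u μ p x z a b| := Finset.abs_sum_le_sum_abs _ _
    _ ≤ ∑ _μ : Fin (d + 1), (Real.exp δ * C * E + C * E) := Finset.sum_le_sum fun μ _ =>
        (abs_sub _ _).trans (add_le_add (hshift μ) (hplain μ))
    _ = ((d : ℝ) + 1) * (Real.exp δ + 1) * C * Real.exp (-δ * l1 (p - u)) * Real.exp (-δ * (l1 (x - u) + l1 (z - u))) := by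
        rw [Finset.sum_const, Finset.card_univ, Fintype.card_fin, nsmul_eq_mul, hE]; push_cast; ring

/-- NOT IN PRINT; OUR BOOKKEEPING.  **THE DOUBLE SLOT DIVERGENCE OF A `LocStencil₂` TABLE CARRIES THE NEST LETTER** (PART 2 §4's hypothesis; `δ ≥ 0`):
`|(divV (κ₂ u₂ ↦ divV (κ₁ u₁ ↦ T κ₁ u₁ κ₂ u₂) p) p′) x z a b| ≤ (d+1)²(e^{3δ}+1)(e^{δ}+1)·C · e^{−δ|p′ − p|₁} · e^{−δ(|x − p|₁ + |z − p|₁)}` — §2's first-slot letter for every second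
slot, then one unit shift in the second slot. -/
theorem letter_fst_snd_of_locStencil₂ (hT : LocStencil₂ T C δ) (hδ : 0 ≤ δ) (p p' x z : Fin (d + 1) → ℤ) (a b : Fib d) :
    |divV (fun κ₂ u₂ => divV (fun κ₁ u₁ => T κ₁ u₁ κ₂ u₂) p) p' x z a b|
      ≤ ((d : ℝ) + 1) ^ 2 * (Real.exp (3 * δ) + 1) * (Real.exp δ + 1) * C
          * Real.exp (-δ * l1 (p' - p)) * Real.exp (-δ * (l1 (x - p) + l1 (z - p))) := by
  have hC : 0 ≤ C := hT.nonneg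
  set C₁ := ((d : ℝ) + 1) * (Real.exp (3 * δ) + 1) * C with hC₁
  have hC₁0 : 0 ≤ C₁ := by rw [hC₁]; positivity
  set E := Real.exp (-δ * l1 (p' - p)) * Real.exp (-δ * (l1 (x - p) + l1 (z - p))) with hE
  have inner : ∀ (ν : Fin (d + 1)) (q : Fin (d + 1) → ℤ), |divV (fun κ₁ u₁ => T κ₁ u₁ ν q) p x z a b|
      ≤ C₁ * Real.exp (-δ * l1 (q - p)) * Real.exp (-δ * (l1 (x - p) + l1 (z - p))) :=
    fun ν q => letter_fst_of_locStencil₂ hT hδ p ν q x z a b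
  have hshift : ∀ ν : Fin (d + 1), |divV (fun κ₁ u₁ => T κ₁ u₁ ν (p' - unitVec ν)) p x z a b| ≤ Real.exp δ * C₁ * E := by
    intro ν
    have h := inner ν (p' - unitVec ν)
    have r1 := exp_shift_unit_le' hδ p' p ν
    rw [hE]
    calc |divV (fun κ₁ u₁ => T κ₁ u₁ ν (p' - unitVec ν)) p x z a b|
        ≤ C₁ * Real.exp (-δ * l1 ((p' - unitVec ν) - p)) * Real.exp (-δ * (l1 (x - p) + l1 (z - p))) := h
      _ ≤ C₁ * (Real.exp δ * Real.exp (-δ * l1 (p' - p))) * Real.exp (-δ * (l1 (x - p) + l1 (z - p))) :=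
          mul_le_mul_of_nonneg_right (mul_le_mul_of_nonneg_left r1 hC₁0) (Real.exp_pos _).le
      _ = Real.exp δ * C₁ * (Real.exp (-δ * l1 (p' - p)) * Real.exp (-δ * (l1 (x - p) + l1 (z - p)))) := by ring
  have hplain : ∀ ν : Fin (d + 1), |divV (fun κ₁ u₁ => T κ₁ u₁ ν p') p x z a b| ≤ C₁ * E := by
    intro ν
    rw [hE, ← mul_assoc]
    exact inner ν p'
  rw [divV_apply (fun κ₂ u₂ => divV (fun κ₁ u₁ => T κ₁ u₁ κ₂ u₂) p)]
  calc |∑ ν : Fin (d + 1), (divV (fun κ₁ u₁ => T κ₁ u₁ ν (p' - unitVec ν)) p x z a b - divV (fun κ₁ u₁ => T κ₁ u₁ ν p') p x z a b)|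
      ≤ ∑ ν : Fin (d + 1), |divV (fun κ₁ u₁ => T κ₁ u₁ ν (p' - unitVec ν)) p x z a b - divV (fun κ₁ u₁ => T κ₁ u₁ ν p') p x z a b| :=
        Finset.abs_sum_le_sum_abs _ _
    _ ≤ ∑ _ν : Fin (d + 1), (Real.exp δ * C₁ * E + C₁ * E) := Finset.sum_le_sum fun ν _ =>
        (abs_sub _ _).trans (add_le_add (hshift ν) (hplain ν))
    _ = ((d : ℝ) + 1) ^ 2 * (Real.exp (3 * δ) + 1) * (Real.exp δ + 1) * C
          * Real.exp (-δ * l1 (p' - p)) * Real.exp (-δ * (l1 (x - p) + l1 (z - p))) := by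
        rw [Finset.sum_const, Finset.card_univ, Fintype.card_fin, nsmul_eq_mul, hE, hC₁]; push_cast; ring

end Letters

/-! ## §3 The slot divergences are additive in the table (so letters of summands add) -/

/-- [folklore] `divV` of a pointwise sum of families, entrywise. -/
theorem divV_add_apply (V W : Fin (d + 1) → (Fin (d + 1) → ℤ) → MKer (d + 1) (Fib d)) (y x z : Fin (d + 1) → ℤ) (a b : Fib d) :
    divV (fun κ u => V κ u + W κ u) y x z a b = divV V y x z a b + divV W y x z a b := by
  rw [divV_apply, divV_apply, divV_apply, ← Finset.sum_add_distrib]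
  refine Finset.sum_congr rfl fun μ _ => ?_
  simp only [Pi.add_apply]
  ring

/-- [folklore] First-slot divergence of a sum of tables, entrywise: `Δ₁ (A + B) = Δ₁ A + Δ₁ B`. -/
theorem divV_fst_add (A B : Tab d) (p : Fin (d + 1) → ℤ) (κ' : Fin (d + 1)) (u' x z : Fin (d + 1) → ℤ) (a b : Fib d) :
    divV (fun κ₁ u₁ => (A + B) κ₁ u₁ κ' u') p x z a b = divV (fun κ₁ u₁ => A κ₁ u₁ κ' u') p x z a b + divV (fun κ₁ u₁ => B κ₁ u₁ κ' u') p x z a b := by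
  rw [← divV_add_apply]
  rfl

/-- [folklore] Second-slot divergence of a sum of tables, entrywise: `Δ₂ (A + B) = Δ₂ A + Δ₂ B`. -/
theorem divV_snd_add (A B : Tab d) (κ : Fin (d + 1)) (u p x z : Fin (d + 1) → ℤ) (a b : Fib d) :
    divV (fun κ₁ u₁ => (A + B) κ u κ₁ u₁) p x z a b = divV (fun κ₁ u₁ => A κ u κ₁ u₁) p x z a b + divV (fun κ₁ u₁ => B κ u κ₁ u₁) p x z a b := by
  rw [← divV_add_apply]
  rfl

/-- [folklore] Double slot divergence of a sum of tables, entrywise: `Δ₂Δ₁ (A + B) = Δ₂Δ₁ A + Δ₂Δ₁ B`. -/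
theorem divV_fst_snd_add (A B : Tab d) (p p' x z : Fin (d + 1) → ℤ) (a b : Fib d) :
    divV (fun κ₂ u₂ => divV (fun κ₁ u₁ => (A + B) κ₁ u₁ κ₂ u₂) p) p' x z a b
      = divV (fun κ₂ u₂ => divV (fun κ₁ u₁ => A κ₁ u₁ κ₂ u₂) p) p' x z a b + divV (fun κ₂ u₂ => divV (fun κ₁ u₁ => B κ₁ u₁ κ₂ u₂) p) p' x z a b := by
  rw [← divV_add_apply]
  have e : (fun κ₂ u₂ => divV (fun κ₁ u₁ => (A + B) κ₁ u₁ κ₂ u₂) p)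
      = fun κ₂ u₂ => divV (fun κ₁ u₁ => A κ₁ u₁ κ₂ u₂) p + divV (fun κ₁ u₁ => B κ₁ u₁ κ₂ u₂) p := by
    funext κ₂ u₂
    funext x' z' a' b'
    rw [Pi.add_apply, Pi.add_apply, Pi.add_apply, Pi.add_apply, ← divV_add_apply]
    rfl
  rw [e]

/-! ## §4 Docking check: a plain `LocStencil₂` table through the window route -/

section Docking

variable {N : ℕ} {r : Fin (d + 1) → ℕ} {T : Tab d} {C δ : ℝ}

/-- NOT IN PRINT; OUR BOOKKEEPING.  **DOCKING CHECK, SECOND SLOT**: `LocStencil₂ T C δ ⟹ LocStencil₂ (P₂ T − T) (2(d+1)N·(2N+1)^{d+1}·e^{δ(d+1)N}·((d+1)(e^{δ}+1)·C)) δ`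
(PART 2 §3 at §2's letter — one term, no adapter). -/
theorem locStencil₂_coProj_snd_sub_self_of_locStencil₂ (hN : 1 ≤ N) (hr : r ∈ box (d + 1) N) (hT : LocStencil₂ T C δ) (hδ : 0 ≤ δ) :
    LocStencil₂ ((fun κ u => coProjBmAtK (toSite r) N (T κ u)) - T)
      (2 * ((d : ℝ) + 1) * N * ((((2 * N + 1) ^ (d + 1) : ℕ) : ℝ) * (Real.exp (δ * (((d : ℝ) + 1) * N)) * (((d : ℝ) + 1) * (Real.exp δ + 1) * C)))) δ :=
  locStencil₂_coProj_snd_sub_self_of_div hN hr T hδ (fun κ u p x z a b => letter_snd_of_locStencil₂ hT hδ κ u p x z a b)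

/-- NOT IN PRINT; OUR BOOKKEEPING.  **DOCKING CHECK, FIRST SLOT**: `LocStencil₂ T C δ ⟹ LocStencil₂ (P₁ T − T) (2(d+1)N·(2N+1)^{d+1}·e^{3δ(d+1)N}·((d+1)(e^{3δ}+1)·C)) δ`. -/
theorem locStencil₂_coProj_fst_sub_self_of_locStencil₂ (hN : 1 ≤ N) (hr : r ∈ box (d + 1) N) (hT : LocStencil₂ T C δ) (hδ : 0 ≤ δ) :
    LocStencil₂ ((fun κ u κ' u' => coProjBmAtK (toSite r) N (fun κ₁ u₁ => T κ₁ u₁ κ' u') κ u) - T)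
      (2 * ((d : ℝ) + 1) * N * ((((2 * N + 1) ^ (d + 1) : ℕ) : ℝ) * (Real.exp (3 * δ * (((d : ℝ) + 1) * N)) * (((d : ℝ) + 1) * (Real.exp (3 * δ) + 1) * C)))) δ :=
  locStencil₂_coProj_fst_sub_self_of_div hN hr T hδ (fun p κ' u' x z a b => letter_fst_of_locStencil₂ hT hδ p κ' u' x z a b)

/-- NOT IN PRINT; OUR BOOKKEEPING.  **DOCKING CHECK, THE `|S| = 2` NEST**:
`LocStencil₂ T C δ ⟹ LocStencil₂ (P₁ (P₂ T − T) − (P₂ T − T)) ((2(d+1)N)²·(2N+1)^{2(d+1)}·e^{4δ(d+1)N}·((d+1)²(e^{3δ}+1)(e^{δ}+1)·C)) δ`. -/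
theorem locStencil₂_defect_fst_snd_of_locStencil₂ (hN : 1 ≤ N) (hr : r ∈ box (d + 1) N) (hT : LocStencil₂ T C δ) (hδ : 0 ≤ δ) :
    LocStencil₂ ((fun κ u κ' u' => coProjBmAtK (toSite r) N (fun κ₁ u₁ => ((fun κ u => coProjBmAtK (toSite r) N (T κ u)) - T) κ₁ u₁ κ' u') κ u)
        - ((fun κ u => coProjBmAtK (toSite r) N (T κ u)) - T))
      ((2 * ((d : ℝ) + 1) * N) ^ 2 * ((((2 * N + 1) ^ (d + 1) : ℕ) : ℝ) * ((((2 * N + 1) ^ (d + 1) : ℕ) : ℝ)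
        * (Real.exp (4 * δ * (((d : ℝ) + 1) * N)) * (((d : ℝ) + 1) ^ 2 * (Real.exp (3 * δ) + 1) * (Real.exp δ + 1) * C))))) δ :=
  locStencil₂_defect_fst_snd_of_div₂ hN hr T hδ (fun p p' x z a b => letter_fst_snd_of_locStencil₂ hT hδ p p' x z a b)

end Docking

end Summit.QuantumFields.BalabanUV.Beta.GAN24.SlotDivergenceLetters

end
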